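import Summits.ABC.ABC.Theses.DefiniteXi
import Literature.NumberTheory.EllipticCurves.OpenImageMazurTwistProofs
import Literature.NumberTheory.EllipticCurves.OpenImageMazurCharacterProofs
import Literature.NumberTheory.EllipticCurves.PastenHeightBoundsLemma68LocalProofs
import Literature.NumberTheory.EllipticCurves.OrdinaryReductionTorsionCharactersProofs
import Literature.NumberTheory.EllipticCurves.OrdinaryReductionUnramifiedCharacterProofs
import Literature.NumberTheory.EllipticCurves.TateCurve.NumberFieldUniformizationTwistedKernelOfReductionIff
import Literature.NumberTheory.EllipticCurves.TateCurve.MultiplicativeTwistUnramifiedProofs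
import Literature.NumberTheory.GaloisRepresentations.DecompositionGroupOfCompletion
import Literature.NumberTheory.GaloisRepresentations.RamificationFiltrationProofs
import Literature.NumberTheory.GaloisRepresentations.TateLevelOneWildOdd
import Literature.NumberTheory.Automorphic.AdicCompletionLocalField
import HarnessLib

/-!
# Stub-ideation k=2 (gen 10, FAMILY 2 — RESHAPE) for `stub_pastenLemma68` — crux `DefiniteRTControlPrime`

Companion to `STUB-IDEAS-stub_pastenLemma68-2.md` (gen 10).  Scratch check that the NEW helper
STATEMENTS of gen 10 elaborate (`sorry` = helper body for one stub-prover cycle; `sorry`-free = proved).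
Gen 10 does NOT re-type gens 3–9 (see `StubIdeasK2G9PastenLemma68.lean` §§1–5 and
`Lines/StubIdeasK2g7_pasten163.lean` §§2–6 for T1⁺/LOC/GLOB⁻/H5⁻/A1/C1/C0²/SUB); it adds:

* §0  the verbatim stub, by name (depth certificate + closer) — verdict `blocked-on: stmt-ABC-15193`.
* §1  CONJ (PROVED) — "one prime above `v` suffices": homomorphisms with abelian target that agree on
      `I_{𝔓₀}` agree on `I_𝔓` for every `𝔓 ∣ v` (`exists_smul_eq_of_mem_primesAbove_holds` +
      `absIntegers.inertia_smul`).  So D2/D3′/LOCℓ/U2/T2 need only be proved at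
      `𝔓₀ := adicCompletionPrime ℚ v`, where `inertia_adicCompletionPrime_eq_map_absInertia` hands over
      LOCAL inertia elements directly.
* §2  D-TRANS (PROVED) — the local→global transport of a two-clause container along
      `pointsMapOfEmb W (closureEmb ℚ_v)`, factored once.
* §3  D2₀ (PROVED — g7's open helper D2 is CLOSED at `𝔓₀`) from the two landed Greenberg facts;
      D3loc (`sorry`, S–M: THE local Tate lemma) and D3′₀ = D3loc + D-TRANS (proved modulo D3loc).
* §4  T2 = PORT of `Mazur1978.isogenyCharacter_sq_eq_one_of_one_lt_valuation_j` (`sorry`, S) with its two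
      non-mechanical ingredients U1k (level-`ℓᵏ` unipotence ⇒ `s ≡ 1 mod ℓ^⌈k/2⌉`) and Z1 (units
      bookkeeping) PROVED here.
Sorries: exactly 2 (D3loc, T2) = the two helper bodies left for stub provers on the `v ∣ 2ℓ` side.
-/

set_option linter.dupNamespace false

namespace Summit.ABC.ABC.Cruxes.DefiniteRTControlPrime.StubIdeas2G10

open Literature.NumberTheory.EllipticCurves Literature.NumberTheory.EllipticCurves.ModularForms
open Literature.NumberTheory.GaloisRepresentations
open Literature
open WeierstrassCurve IsDedekindDomain NumberField Field
open scoped NumberField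

/-! ## §0 The verbatim stub, by name -/

/-- Closer-in-waiting (tree): Mazur–Kenku ⇒ the stub. -/
example : mazurKenku_exists_cyclic_isogeny → PastenShimura2024_lemma_6_8 :=
  PastenShimura2024_lemma_6_8_of_mazurKenku'

/-- Depth certificate (tree): the stub AS TYPED bounds prime isogeny degrees at a multiplicative place
(Mazur 1978 Thm 1 / Cor 4.4 territory) — no Mazur-free proof of the verbatim signature. -/
example (h68 : PastenShimura2024_lemma_6_8) {W W' : WeierstrassCurve ℚ} [W.IsElliptic] [W'.IsElliptic]
    (φ : Isogeny W W') {ℓ : ℕ} (hℓ : ℓ.Prime) (hdeg : φ.degree = ℓ) (v : HeightOneSpectrum ℤ)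
    (hv : W.HasMultiplicativeReductionAt v) : ℓ ≤ 163 :=
  prime_degree_le_163_of_PastenShimura2024_lemma_6_8 h68 φ hℓ hdeg v hv

/-! ## §1 CONJ — one prime above `v` suffices for characters with abelian target -/

/-- **CONJ (PROVED, XS).**  Two homomorphisms `Γ_K → M` into a commutative group that agree on the
inertia group of ONE prime `𝔓₀ ∣ v` of `K̄` agree on the inertia group of EVERY prime `𝔓 ∣ v`
(`𝔓 = g • 𝔓₀`, `I_{g𝔓₀} = g I_{𝔓₀} g⁻¹`, and `ψᵢ (g τ g⁻¹) = ψᵢ τ`). [folklore] -/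
theorem eqOn_inertia_of_eqOn_inertia_one {K : Type*} [Field K] [NumberField K] {M : Type*}
    [CommGroup M] (ψ₁ ψ₂ : absoluteGaloisGroup K →* M) (v : HeightOneSpectrum (𝓞 K))
    {𝔓₀ : Ideal (absIntegers (𝓞 K) K)} (h𝔓₀ : 𝔓₀ ∈ v.primesAbove)
    (h : ∀ τ ∈ 𝔓₀.inertia (absoluteGaloisGroup K), ψ₁ τ = ψ₂ τ)
    {𝔓 : Ideal (absIntegers (𝓞 K) K)} (h𝔓 : 𝔓 ∈ v.primesAbove)
    {τ : absoluteGaloisGroup K} (hτ : τ ∈ 𝔓.inertia (absoluteGaloisGroup K)) :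
    ψ₁ τ = ψ₂ τ := by
  obtain ⟨g, rfl⟩ := HeightOneSpectrum.exists_smul_eq_of_mem_primesAbove_holds h𝔓₀ h𝔓
  rw [absIntegers.inertia_smul, Subgroup.mem_pointwise_smul_iff_inv_smul_mem] at hτ
  have key := h _ hτ
  simp only [MulAut.smul_def] at key
  simpa [map_mul, map_inv, mul_inv_cancel_comm, inv_mul_cancel_comm] using key

/-- CONJ, trivial-character form (the shape consumed by `Mazur1978.monoidHom_eq_one_of_forall_inertia`). -/
theorem forall_inertia_eq_one_of_one {K : Type*} [Field K] [NumberField K] {M : Type*}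
    [CommGroup M] (ψ : absoluteGaloisGroup K →* M) (v : HeightOneSpectrum (𝓞 K))
    {𝔓₀ : Ideal (absIntegers (𝓞 K) K)} (h𝔓₀ : 𝔓₀ ∈ v.primesAbove)
    (h : ∀ τ ∈ 𝔓₀.inertia (absoluteGaloisGroup K), ψ τ = 1) :
    ∀ 𝔓 ∈ v.primesAbove, ∀ τ ∈ 𝔓.inertia (absoluteGaloisGroup K), ψ τ = 1 := by
  intro 𝔓 h𝔓 τ hτ
  have := eqOn_inertia_of_eqOn_inertia_one ψ 1 v h𝔓₀ (by simpa using h) h𝔓 hτ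
  simpa using this

/-! ## §2 D-TRANS — the local→global transport of a two-clause container, factored ONCE

Both containers at `v ∣ ℓ` (ordinary D2, multiplicative D3′) have the same two clauses; gens 3–9 asked
each prover to redo the transport `I_𝔓 ↝ I_{ℚ_v}`, `E(ℚ̄) ↪ E(ℚ̄_v)`.  At `𝔓₀ = adicCompletionPrime ℚ v`
the transport is generic and tiny: `I_{𝔓₀} = res (absInertia ℚ_v)`
(`inertia_adicCompletionPrime_eq_map_absInertia`), `ι (res σ • P) = σ • ι P` (`pointsMapOfEmb_smul`,
`resGal = absGaloisRestrict` rfl), `ι` injective, `χ^{glob}_m (res σ) = χ^{loc}_m σ`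
(`modNCyclotomicCharacter_absGaloisRestrict`).  CONJ (§1) then serves every other `𝔓 ∣ v` for the
CHARACTER-level consequences (LOCℓ's dichotomy `r|_{I} ∈ {1, χ}` is a statement about characters). -/

/-- **D-TRANS (PROVED; transport only).**  A local two-clause container `E₁loc ≤ E(ℚ̄_v)` for
`absInertia ℚ_v` and the LOCAL mod-`m` cyclotomic character yields the global two-clause container
`ι⁻¹ E₁loc ≤ E(ℚ̄)` for `I_{𝔓₀}` and the GLOBAL character. [folklore] -/
theorem container_of_local (W : WeierstrassCurve ℚ) [W.IsElliptic] (v : HeightOneSpectrum (𝓞 ℚ))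
    (m : ℕ) [NeZero m] [NeZero (m : v.adicCompletion ℚ)]
    (E₁loc : AddSubgroup (localPoints W (v.adicCompletion ℚ)))
    (h1 : ∀ σ ∈ absInertia (v.adicCompletion ℚ), ∀ Q ∈ E₁loc, m • Q = 0 →
      σ • Q = ((modNCyclotomicCharacter (v.adicCompletion ℚ) m σ : (ZMod m)ˣ) : ZMod m).val • Q)
    (h2 : ∀ σ ∈ absInertia (v.adicCompletion ℚ), ∀ Q : localPoints W (v.adicCompletion ℚ),
      m • Q = 0 → σ • Q - Q ∈ E₁loc) :
    (∀ τ ∈ (adicCompletionPrime ℚ v).inertia (absoluteGaloisGroup ℚ),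
        ∀ Q ∈ E₁loc.comap (pointsMapOfEmb W (closureEmb (v.adicCompletion ℚ))), m • Q = 0 →
        τ • Q = ((((modNCyclotomicCharacter ℚ m τ : (ZMod m)ˣ) : ZMod m).val : ℤ)) • Q) ∧
    (∀ τ ∈ (adicCompletionPrime ℚ v).inertia (absoluteGaloisGroup ℚ), ∀ Q : geomPoints W,
        m • Q = 0 → τ • Q - Q ∈ E₁loc.comap (pointsMapOfEmb W (closureEmb (v.adicCompletion ℚ)))) := by
  have hinj := pointsMapOfEmb_injective W (closureEmb (K := ℚ) (v.adicCompletion ℚ))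
  have hequiv : ∀ (σ : absoluteGaloisGroup (v.adicCompletion ℚ)) (P : geomPoints W),
      pointsMapOfEmb W (closureEmb (K := ℚ) (v.adicCompletion ℚ))
          (absGaloisRestrict ℚ (v.adicCompletion ℚ) σ • P) =
        σ • pointsMapOfEmb W (closureEmb (K := ℚ) (v.adicCompletion ℚ)) P := by
    intro σ P
    rw [← resGal_eq_absGaloisRestrict, resGal_eq, pointsMapOfEmb_smul]
  constructor
  · intro τ hτ Q hQ hQm
    rw [inertia_adicCompletionPrime_eq_map_absInertia ℚ v] at hτ
    obtain ⟨σ, hσ, rfl⟩ := Subgroup.mem_map.mp hτ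
    change absGaloisRestrict ℚ (v.adicCompletion ℚ) σ • Q =
      ((((modNCyclotomicCharacter ℚ m (absGaloisRestrict ℚ (v.adicCompletion ℚ) σ) :
        (ZMod m)ˣ) : ZMod m).val : ℤ)) • Q
    rw [modNCyclotomicCharacter_absGaloisRestrict, natCast_zsmul]
    apply hinj
    rw [hequiv, map_nsmul]
    refine h1 σ hσ _ (AddSubgroup.mem_comap.mp hQ) ?_
    rw [← map_nsmul, hQm, map_zero]
  · intro τ hτ Q hQm
    rw [inertia_adicCompletionPrime_eq_map_absInertia ℚ v] at hτ
    obtain ⟨σ, hσ, rfl⟩ := Subgroup.mem_map.mp hτ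
    change absGaloisRestrict ℚ (v.adicCompletion ℚ) σ • Q - Q ∈ _
    rw [AddSubgroup.mem_comap, map_sub, hequiv]
    refine h2 σ hσ _ ?_
    rw [← map_nsmul, hQm, map_zero]

/-! ## §3 The two containers AT `𝔓₀`

D2₀ = the two landed Greenberg facts, read at `𝔓₀` (they are ALREADY phrased on `geomPoints W` with
`absGaloisRestrict`, so not even D-TRANS is needed — only the `χ` conversions).  D3loc = the purely LOCAL
Tate lemma (the one remaining piece of mathematics at `v = ℓ` multiplicative), then D-TRANS. -/

/-- **D2₀ (PROVED; inputs: `ordinaryReduction_inertia_smul_of_mem_kernelReduction_holds`,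
`ordinaryReduction_exists_unramified_character_mod_kernelReduction_holds`).**  The ordinary container at
`𝔓₀ = adicCompletionPrime ℚ v`, witness `E₁ := ι⁻¹ E₁(ℚ̄_v)`. [cite: GreenbergLNM1716, §2] -/
theorem exists_ordinaryFiltration_adicCompletionPrime (W : WeierstrassCurve ℚ) [W.IsElliptic]
    {v : HeightOneSpectrum (𝓞 ℚ)} (hgood : W.HasGoodReductionAt v) {ℓ : ℕ} [Fact ℓ.Prime]
    (hℓv : (ℓ : 𝓞 ℚ) ∈ v.asIdeal) (hord : ¬ ((ℓ : ℤ) ∣ W.frobeniusTraceAt v)) (k : ℕ) :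
    ∃ E₁ : AddSubgroup (geomPoints W),
      (∀ τ ∈ (adicCompletionPrime ℚ v).inertia (absoluteGaloisGroup ℚ), ∀ Q ∈ E₁, ℓ ^ k • Q = 0 →
        τ • Q = ((((modNCyclotomicCharacter ℚ (ℓ ^ k) τ : (ZMod (ℓ ^ k))ˣ) :
          ZMod (ℓ ^ k)).val : ℤ)) • Q) ∧
      (∀ τ ∈ (adicCompletionPrime ℚ v).inertia (absoluteGaloisGroup ℚ), ∀ Q : geomPoints W,
        ℓ ^ k • Q = 0 → τ • Q - Q ∈ E₁) := by
  -- `NeZero` in `ℚ_v` WITHOUT putting `CharZero ℚ_v` in scope (that would let `DivisionRing.toRatAlgebra`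
  -- compete with `instAlgebraAdicCompletion` — the instance diamond that makes `change` fail).
  haveI : NeZero ((ℓ : ℕ) : v.adicCompletion ℚ) :=
    NeZero.nat_of_injective (algebraMap ℚ (v.adicCompletion ℚ)).injective
  haveI : NeZero ((ℓ ^ k : ℕ) : v.adicCompletion ℚ) :=
    NeZero.nat_of_injective (algebraMap ℚ (v.adicCompletion ℚ)).injective
  refine ⟨(W.localKernelOfReduction v).comap (pointsMapOfEmb W (closureEmb (v.adicCompletion ℚ))),
    ?_, ?_⟩
  · intro τ hτ Q hQ hQk
    rw [inertia_adicCompletionPrime_eq_map_absInertia ℚ v] at hτ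
    obtain ⟨σ, hσ, rfl⟩ := Subgroup.mem_map.mp hτ
    change absGaloisRestrict ℚ (v.adicCompletion ℚ) σ • Q =
      ((((modNCyclotomicCharacter ℚ (ℓ ^ k) (absGaloisRestrict ℚ (v.adicCompletion ℚ) σ) :
        (ZMod (ℓ ^ k))ˣ) : ZMod (ℓ ^ k)).val : ℤ)) • Q
    rw [modNCyclotomicCharacter_absGaloisRestrict, natCast_zsmul,
      modNCyclotomicCharacter_eq_toZModPow_cyclotomicCharacter]
    exact ordinaryReduction_inertia_smul_of_mem_kernelReduction_holds W ℓ v hℓv hgood hord σ hσ k Q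
      hQk (AddSubgroup.mem_comap.mp hQ)
  · intro τ hτ Q hQk
    rw [inertia_adicCompletionPrime_eq_map_absInertia ℚ v] at hτ
    obtain ⟨σ, hσ, rfl⟩ := Subgroup.mem_map.mp hτ
    obtain ⟨φ, hφI, -, hφ⟩ :=
      ordinaryReduction_exists_unramified_character_mod_kernelReduction_holds W ℓ v hℓv hgood hord
    have h := hφ σ k Q hQk
    rw [hφI σ hσ, Units.val_one, map_one] at h
    change absGaloisRestrict ℚ (v.adicCompletion ℚ) σ • Q - Q ∈ _
    rw [AddSubgroup.mem_comap]
    rcases Nat.eq_zero_or_pos k with rfl | hk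
    · have hQ0 : Q = 0 := by simpa using hQk
      rw [hQ0, smul_zero, sub_zero, map_zero]
      exact AddSubgroup.zero_mem _
    · haveI : Fact (1 < ℓ ^ k) := ⟨Nat.one_lt_pow hk.ne' (Fact.out : ℓ.Prime).one_lt⟩
      rwa [ZMod.val_one, one_smul] at h

/-- **D3loc (S–M; THE local lemma; inputs PROVED: `TateCurve.exists_twistedTateUniformisation_localKernelOfReduction_iff`
(`Ψ : ℚ̄_vˣ ↠ E(ℚ̄_v)`, kernel `q^ℤ`, `σ•Ψ(u) = ±Ψ(σu)` with `+` iff `σ t = t`, and `E₁(ℚ̄_v) = Ψ(1 + 𝔪)`),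
`TateCurve.toAlgEquiv_eq_of_mem_inertia_of_sq_eq_gamma` (inertia FIXES `t = √γ`: sign `+1`) read through
`HeightOneSpectrum.inertia_eq_absInertia`).**  At a multiplicative `v ∣ ℓ`: (i) an `ℓᵏ`-torsion point of
`E₁(ℚ̄_v)` is `Ψ(u)`, `u` a principal unit with `u^{ℓᵏ} ∈ q^ℤ ∩ (1 + 𝔪) = {1}`, so `u = ζ ∈ μ_{ℓᵏ}` and
`σ•Ψ(ζ) = Ψ(ζ^{χ(σ)}) = χ(σ)•Ψ(ζ)` (`modNCyclotomicCharacter_spec`); (ii) for `ℓᵏ Ψ(u) = 0`,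
`u^{ℓᵏ} ∈ q^ℤ ⊂ ℚ_v` so `(σu/u)^{ℓᵏ} = 1`, `σ•Ψ(u) − Ψ(u) = Ψ(σu/u) = Ψ(ζ)` with `|ζ − 1|_v < 1`
(`v ∣ ℓ`), i.e. `∈ E₁(ℚ̄_v)`. [cite: SilvermanATAEC1994, §V.4–V.5] -/
theorem exists_multiplicativeContainer_local (W : WeierstrassCurve ℚ) [W.IsElliptic]
    {v : HeightOneSpectrum (𝓞 ℚ)} (hv : W.HasMultiplicativeReductionAt v) {ℓ : ℕ} [Fact ℓ.Prime]
    (hℓv : (ℓ : 𝓞 ℚ) ∈ v.asIdeal) (k : ℕ) [NeZero ((ℓ ^ k : ℕ) : v.adicCompletion ℚ)] :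
    (∀ σ ∈ absInertia (v.adicCompletion ℚ), ∀ Q ∈ W.localKernelOfReduction v, ℓ ^ k • Q = 0 →
        σ • Q = ((modNCyclotomicCharacter (v.adicCompletion ℚ) (ℓ ^ k) σ : (ZMod (ℓ ^ k))ˣ) :
          ZMod (ℓ ^ k)).val • Q) ∧
      (∀ σ ∈ absInertia (v.adicCompletion ℚ), ∀ Q : localPoints W (v.adicCompletion ℚ),
        ℓ ^ k • Q = 0 → σ • Q - Q ∈ W.localKernelOfReduction v) := by
  sorry

/-- **D3′₀ = D3loc + D-TRANS (PROVED modulo D3loc).**  The multiplicative container at `𝔓₀`. -/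
theorem exists_multiplicativeFiltration_adicCompletionPrime (W : WeierstrassCurve ℚ) [W.IsElliptic]
    {v : HeightOneSpectrum (𝓞 ℚ)} (hv : W.HasMultiplicativeReductionAt v) {ℓ : ℕ} [Fact ℓ.Prime]
    (hℓv : (ℓ : 𝓞 ℚ) ∈ v.asIdeal) (k : ℕ) [NeZero ((ℓ ^ k : ℕ) : v.adicCompletion ℚ)] :
    ∃ E₁ : AddSubgroup (geomPoints W),
      (∀ τ ∈ (adicCompletionPrime ℚ v).inertia (absoluteGaloisGroup ℚ), ∀ Q ∈ E₁, ℓ ^ k • Q = 0 →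
        τ • Q = ((((modNCyclotomicCharacter ℚ (ℓ ^ k) τ : (ZMod (ℓ ^ k))ˣ) :
          ZMod (ℓ ^ k)).val : ℤ)) • Q) ∧
      (∀ τ ∈ (adicCompletionPrime ℚ v).inertia (absoluteGaloisGroup ℚ), ∀ Q : geomPoints W,
        ℓ ^ k • Q = 0 → τ • Q - Q ∈ E₁) := by
  obtain ⟨h1, h2⟩ := exists_multiplicativeContainer_local W hv hℓv k
  exact ⟨_, container_of_local W v (ℓ ^ k) (W.localKernelOfReduction v) h1 h2⟩

/-! ## §4 T2 at level `ℓᵏ` = a mechanical PORT of `Mazur1978.isogenyCharacter_sq_eq_one_of_one_lt_valuation_j` -/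

/-- `⌈k/2⌉` (g3 verbatim). -/
def halfCeil (k : ℕ) : ℕ := (k + 1) / 2

theorem halfCeil_le (k : ℕ) : halfCeil k ≤ k := by unfold halfCeil; omega

theorem pow_halfCeil_dvd (ℓ k : ℕ) : ℓ ^ halfCeil k ∣ ℓ ^ k := pow_dvd_pow ℓ (halfCeil_le k)

/-- U1 (PROVED, g3 verbatim, copied so this file is self-contained): `(s−1)²·P = 0` for `P` of order
`ℓᵏ` forces `ℓ^⌈k/2⌉ ∣ s − 1`. -/
theorem pow_halfCeil_dvd_of_sq_smul_eq_zero {M : Type*} [AddCommGroup M] {ℓ k : ℕ} (hℓ : ℓ.Prime)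
    {P : M} (hP : addOrderOf P = ℓ ^ k) {s : ℤ} (hs : ((s - 1) ^ 2) • P = 0) :
    (ℓ : ℤ) ^ halfCeil k ∣ s - 1 := by
  haveI := Fact.mk hℓ
  have h1 : ((ℓ : ℤ) ^ k) ∣ (s - 1) ^ 2 := by
    have := addOrderOf_dvd_iff_zsmul_eq_zero.mpr hs
    rw [hP] at this
    exact_mod_cast this
  rcases eq_or_ne (s - 1) 0 with h0 | h0
  · rw [h0]; exact dvd_zero _
  rw [padicValInt_dvd_iff] at h1 ⊢
  refine Or.inr ?_
  rcases h1 with h1 | h1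
  · exact absurd (pow_eq_zero_iff two_ne_zero |>.mp h1) h0
  · rw [pow_two, padicValInt.mul h0 h0] at h1
    unfold halfCeil
    omega

/-- **U1k (PROVED): the level-`ℓᵏ` replacement for `Mazur1978.intCast_eq_one_of_unipotent`.**  A unipotent
endomorphism `τ` acting on a point `Q` of order `ℓᵏ` by the scalar `s` has `s ≡ 1 (mod ℓ^⌈k/2⌉)`
(sharp: `11a3 → 11a2`, `(ℤ/9)²` at `v = 11`). -/
theorem pow_halfCeil_dvd_sub_one_of_unipotent {A : Type*} [AddCommGroup A] {ℓ k : ℕ} (hℓ : ℓ.Prime)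
    {Q : A} (hQ : addOrderOf Q = ℓ ^ k) (τ : A →+ A) {s : ℤ} (hs : τ Q = s • Q)
    (hunip : τ (τ Q - Q) = τ Q - Q) : (ℓ : ℤ) ^ halfCeil k ∣ s - 1 := by
  have h1 : ((s - 1) ^ 2) • Q = 0 := by
    rw [map_sub, hs, map_zsmul, hs, smul_smul] at hunip
    have h2 : (s * s - s - (s - 1)) • Q = 0 := by
      rw [sub_smul, sub_smul, sub_smul, one_smul, hunip, sub_self]
    rw [show (s - 1) ^ 2 = s * s - s - (s - 1) by ring]
    exact h2
  exact pow_halfCeil_dvd_of_sq_smul_eq_zero hℓ hQ h1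

/-- **Z1 (PROVED): units bookkeeping for the port's last step.**  If `s ≡ ±r (mod ℓᵏ)` and
`ℓ^⌈k/2⌉ ∣ s − 1` then `r̄² = 1` in `(ℤ/ℓ^⌈k/2⌉)ˣ`. -/
theorem unitsMap_sq_eq_one_of_dvd_sub_one {ℓ k : ℕ} [NeZero (ℓ ^ k)] (r : (ZMod (ℓ ^ k))ˣ) {s : ℤ}
    (hsr : ((s : ℤ) : ZMod (ℓ ^ k)) = (r : ZMod (ℓ ^ k)) ∨ ((s : ℤ) : ZMod (ℓ ^ k)) = -(r : ZMod (ℓ ^ k)))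
    (hdiv : (ℓ : ℤ) ^ halfCeil k ∣ s - 1) :
    ZMod.unitsMap (pow_halfCeil_dvd ℓ k) r ^ 2 = 1 := by
  have hs1 : ((s : ℤ) : ZMod (ℓ ^ halfCeil k)) = 1 := by
    have h : (((s - 1 : ℤ)) : ZMod (ℓ ^ halfCeil k)) = 0 := by
      rw [ZMod.intCast_zmod_eq_zero_iff_dvd]; exact_mod_cast hdiv
    rwa [Int.cast_sub, Int.cast_one, sub_eq_zero] at h
  have hcast : ((ZMod.unitsMap (pow_halfCeil_dvd ℓ k) r : (ZMod (ℓ ^ halfCeil k))ˣ) :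
      ZMod (ℓ ^ halfCeil k)) = ZMod.castHom (pow_halfCeil_dvd ℓ k) (ZMod (ℓ ^ halfCeil k))
        (r : ZMod (ℓ ^ k)) := rfl
  apply Units.ext
  rw [Units.val_pow_eq_pow_val, Units.val_one, hcast]
  rcases hsr with h | h
  · rw [← h, map_intCast, hs1, one_pow]
  · rw [show (r : ZMod (ℓ ^ k)) = -((s : ℤ) : ZMod (ℓ ^ k)) by rw [h, neg_neg], map_neg, map_intCast,
      hs1, neg_one_sq]

/-- **T2 (S; = PORT).**  `v(j) < 0` at a place `v ∤ ℓ` ⇒ `r̄(τ)² = 1` on inertia at `v` at HALF level.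
RECIPE (line-by-line from `Mazur1978.isogenyCharacter_sq_eq_one_of_one_lt_valuation_j`,
`OpenImageMazurTwistProofs.lean` ll. 230–300, with `N ↦ ℓᵏ`): twist `d` with multiplicative reduction
(`exists_hasMultiplicativeReductionAt_quadraticTwist_of_one_lt_valuation_j`), signed transport
`exists_addEquiv_geomPoints_quadraticTwist_signed` (`addOrderOf` is preserved by the `AddEquiv`),
unipotence `smul_smul_sub_eq_of_mem_inertia_geomPoints hmult hℓ hℓv (n := k) hk h𝔓 hτ _` (the engine
ALREADY takes `p ^ n`), then U1k in place of `intCast_eq_one_of_unipotent`, and Z1 to finish.  Valid at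
`v = 2` (closes g9's "v = 2 gap": `ℓ` odd ⇒ `(ℓ : 𝓞 ℚ) ∉ v`). [cite: Mazur1978, §5 Prop. 5.1] -/
theorem unitsMap_cyclicCharacter_sq_eq_one_of_one_lt_valuation_j (W : WeierstrassCurve ℚ)
    [W.IsElliptic] {v : HeightOneSpectrum (𝓞 ℚ)} (hj : 1 < v.valuation ℚ W.j)
    {ℓ k : ℕ} [Fact ℓ.Prime] (hℓv : (ℓ : 𝓞 ℚ) ∉ v.asIdeal) (hk : 1 ≤ k)
    {P : geomPoints W} (hP : addOrderOf P = ℓ ^ k)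
    {r : absoluteGaloisGroup ℚ →* (ZMod (ℓ ^ k))ˣ}
    (hr : ∀ σ : absoluteGaloisGroup ℚ, σ • P = ((r σ : (ZMod (ℓ ^ k))ˣ) : ZMod (ℓ ^ k)).val • P)
    {𝔓 : Ideal (absIntegers (𝓞 ℚ) ℚ)} (h𝔓 : 𝔓 ∈ v.primesAbove)
    {τ : absoluteGaloisGroup ℚ} (hτ : τ ∈ 𝔓.inertia (absoluteGaloisGroup ℚ)) :
    ZMod.unitsMap (pow_halfCeil_dvd ℓ k) (r τ) ^ 2 = 1 := by
  sorry

/-! ## §5 In-kernel sanity -/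

example : halfCeil 1 = 1 ∧ halfCeil 2 = 1 ∧ halfCeil 3 = 2 ∧ halfCeil 4 = 2 := by decide

/-- The `NeZero ((ℓ ^ k : ℕ) : ℚ_v)` binders of D3loc / D3′₀ are discharged like this (do NOT put
`CharZero ℚ_v` in scope: `DivisionRing.toRatAlgebra` then competes with `instAlgebraAdicCompletion`). -/
example (v : HeightOneSpectrum (𝓞 ℚ)) (ℓ k : ℕ) [Fact ℓ.Prime] :
    NeZero ((ℓ ^ k : ℕ) : v.adicCompletion ℚ) :=
  NeZero.nat_of_injective (algebraMap ℚ (v.adicCompletion ℚ)).injective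

end Summit.ABC.ABC.Cruxes.DefiniteRTControlPrime.StubIdeas2G10
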